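import Summits.HodgeConjecture.HodgeConjecture.Theorems.Ring2AbelianAllCMTwistedCarriersDefs
import Summits.HodgeConjecture.HodgeConjecture.Theorems.VHCAbelianSchemesRoadServedFibreCM
import Summits.HodgeConjecture.HodgeConjecture.Theorems.Ring2AbelianAllAndreMinimal
import Summits.HodgeConjecture.HodgeConjecture.Theses.VHCAbelianSchemesRoad
import HarnessLib

/-!
# Ring 2 / AbelianAll (André column) — `HC_AV` FROM CM-ANCHORED TWISTED CARRIERS: the cell-free edge of PART AA on the cell's named decls

research route, not a corollary; conditional on HC_CM plus one named minimal statement.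

The §AbelianAll implication table (`RING2-MAP.md`) records edges `HC_CM + X ⟹ HC_AV`. PART AA-f (`VHCAbelianSchemesRoadServedFibreCM`) proved
in the kernel, for every door `𝒪` satisfying its local variational Hodge statement: André's Lemme 6.3.1 ∧ «`𝒪`-carriers with sides on the
`θ`-ray for every rational `(p,p)` class on every CM abelian `n`-fold, `2 ≤ p`, `2p + 4 ≤ n`» ⟹ `∀ A, HodgeConjectureFor A.dim A.X`. This file
states that edge on the cell's NAMED decls — `PadicSemiregularLift.HodgeAbelianVarieties` (`HC_AV`), `RankFourFaces.CMAbelianHodge` (`HC_CM`), the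
node `CMAnchoredCarriers 𝒪` / `CMTwistedCarriers` (AA-g), the road's binders `ChernCharacterOnBetti` (K-C), `TwistedPerfectDoor`,
`AndreCMAnchoredPencil` (#21) BY NAME:

* §1 `HC_AV_of_andre1996_of_door_of_cmAnchoredCarriers` (door-generic) and **`HC_AV_of_cmTwistedCarriers : K-C → TwistedPerfectDoor → #21 →
  CMTwistedCarriers → HC_AV`** — NO `HC_CM`, NO K-SR♭∃, NO curve residual, NO #22.
* §2 `HC_CM_of_cmTwistedCarriers` — with the same binders the node IMPLIES `HC_CM` (as the CM case of `HC_AV`): in the table's currency the row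
  «`X := CMTwistedCarriers`» has `HC_CM` IDLE (the deliverable shape `HC_CM → X → HC_AV` holds with the first hypothesis unused, so it is not
  stated as a theorem with a dead binder).
* §3 Edges INTO the node: `cmAnchoredCarriers_of_HC_CM_of_forall_pinnedDesignAt` — `HC_CM` ∧ PART Z's pinned design problems
  `PinnedDesignAt 𝒪 n p` (`2 ≤ p`, `2p + 4 ≤ n`) ⟹ `CMAnchoredCarriers 𝒪` (at a CM anchor every rational `(p,p)` class is algebraic by `HC_CM`,
  `Ring2Transport.mem_algebraicClasses_of_cmChart`); twisted form `cmTwistedCarriers_of_HC_CM_of_forall_pinnedDesignAt`.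

HONEST: `CMTwistedCarriers` is OPEN, not in print, and NOT implied by the Hodge conjecture (a carrier is more than algebraicity), so this row
has no `…_of_HodgeConjecture` on-path companion; Lemme 6.3.1 is a REFEREED named fact entering BY NAME as a hypothesis. Nothing here says
`CMTwistedCarriers`, `HC_CM`, `HC_AV` or HC holds. References: [cite: Andre1996Motifs, §6.3 Lemme 6.3.1 and a)]
[cite: Bloch1972Semiregularity, Remark (7.5)] [cite: BuchweitzFlenner2003, §5 Thm. 5.1] [cite: Pridham2024Semiregularity, Cor. 2.25 and Rem. 2.27]
[cite: Milne1999, §7 p. 72].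
-/

noncomputable section

open CategoryTheory CategoryTheory.Limits AlgebraicGeometry Topology

namespace Summit.HodgeConjecture.HodgeConjecture.Ring2.AbelianAll

-- the cell's namespace repeats the summit name (`Summit.HodgeConjecture.HodgeConjecture…`), as in every `Ring2*` file
set_option linter.dupNamespace false

open Literature.AlgebraicGeometry Literature.AlgebraicGeometry.Motives
open Literature.AlgebraicGeometry.HodgeTheory
open Literature.AlgebraicTopology.SingularHomology
open Literature.AlgebraicGeometry.Milne1999 (IsOfCMType)
open Literature.AlgebraicGeometry.Andre1996 (andre1996_cmAnchoredPencil)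
open Summit.Ventures.HSemireg (ObjClass LocalVariationalHodgeFor)
open Summit.HodgeConjecture.HodgeConjecture.Theses
open Summit.HodgeConjecture.HodgeConjecture.Ring2.Deform (HC_CM_of_HC_AV)
open Summit.HodgeConjecture.HodgeConjecture.Ring2.SemiregularRepresentatives (AnchoredCarrierAt PinnedDesignAt
  forall_hodgeConjectureFor_of_cmAnchoredPencil_of_cmAnchoredCarrierAt twistedPerfectDoorVHC_iff_localVariationalHodgeFor)

/-! ## §1 `HC_AV` from CM-anchored carriers -/

/-- **`HC_AV` from André's Lemme 6.3.1, the door's local variational Hodge statement and CM-ANCHORED `𝒪`-CARRIERS** (door-generic; cell-free;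
`HC_CM` is not a hypothesis). [cite: Andre1996Motifs, §6.3 Lemme 6.3.1 and a)] [cite: BuchweitzFlenner2003, §5 Thm. 5.1]
[cite: Bloch1972Semiregularity, Remark (7.5)] -/
theorem HC_AV_of_andre1996_of_door_of_cmAnchoredCarriers (h₂₁ : andre1996_cmAnchoredPencil) {𝒪 : ObjClass}
    (hT : LocalVariationalHodgeFor 𝒪) (hB : CMAnchoredCarriers 𝒪) : PadicSemiregularLift.HodgeAbelianVarieties :=
  fun A ↦ forall_hodgeConjectureFor_of_cmAnchoredPencil_of_cmAnchoredCarrierAt h₂₁ hT (fun n p h2 h4 ↦ hB n p h2 h4) A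

/-- **`HC_AV ⟸ K-C ∧ TwistedPerfectDoor ∧ AndreCMAnchoredPencil ∧ CMTwistedCarriers`** — the road's binders BY NAME (a Chern character theory
`C` exists; the twisted door's local variational Hodge statement; André's Lemme 6.3.1) and the node of PART AA-g. NOT used: `HC_CM`, the crux
K-SR♭∃ / its cells, the curve residual `RaynaudSectionProjective`, André #22. [cite: Andre1996Motifs, §6.3 Lemme 6.3.1]
[cite: Pridham2024Semiregularity, Cor. 2.25 and Rem. 2.27] [cite: Bloch1972Semiregularity, Remark (7.5)] -/
theorem HC_AV_of_cmTwistedCarriers (hC : VHCAbelianSchemesRoad.ChernCharacterOnBetti) (hDoor : VHCAbelianSchemesRoad.TwistedPerfectDoor)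
    (h₂₁ : VHCAbelianSchemesRoad.AndreCMAnchoredPencil) (hB : CMTwistedCarriers) : PadicSemiregularLift.HodgeAbelianVarieties := by
  obtain ⟨C⟩ := (hC : Nonempty ChernCharacterBetti)
  exact HC_AV_of_andre1996_of_door_of_cmAnchoredCarriers h₂₁ ((twistedPerfectDoorVHC_iff_localVariationalHodgeFor C _).1 (hDoor C)) (hB C)

/-! ## §2 The node implies `HC_CM` (with the same binders): the table row has `HC_CM` idle -/

/-- **`CMTwistedCarriers` (with K-C, the door and #21) implies `HC_CM`** — the CM case of §1. So in the deliverable currency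
`HC_CM → B_min → HC_AV` the row `B_min := CMTwistedCarriers` holds with `HC_CM` UNUSED. [cite: Andre1996Motifs, §6.3 Lemme 6.3.1]
[cite: Milne1999, §7 p. 72] -/
theorem HC_CM_of_cmTwistedCarriers (hC : VHCAbelianSchemesRoad.ChernCharacterOnBetti) (hDoor : VHCAbelianSchemesRoad.TwistedPerfectDoor)
    (h₂₁ : VHCAbelianSchemesRoad.AndreCMAnchoredPencil) (hB : CMTwistedCarriers) : RankFourFaces.CMAbelianHodge :=
  HC_CM_of_HC_AV (HC_AV_of_cmTwistedCarriers hC hDoor h₂₁ hB)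

/-! ## §3 Edges into the node: `HC_CM` and the pinned design problems -/

/-- **`HC_CM` ∧ the pinned design problems of PART Z give CM-anchored carriers**: at a CM anchor `X ≅ A₀.X` every rational `(p,p)` class is
algebraic by `HC_CM` (`Ring2Transport.mem_algebraicClasses_of_cmChart`), so `PinnedDesignAt 𝒪 n p` (carriers for rational ALGEBRAIC classes on
every polarised abelian `n`-fold) applies. [cite: Bloch1972Semiregularity, Remark (7.5)] [cite: Milne1999, §7 p. 72] -/
theorem cmAnchoredCarriers_of_HC_CM_of_forall_pinnedDesignAt (hCM : RankFourFaces.CMAbelianHodge) {𝒪 : ObjClass}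
    (h : ∀ n p : ℕ, 2 ≤ p → 2 * p + 4 ≤ n → PinnedDesignAt 𝒪 n p) : CMAnchoredCarriers 𝒪 := by
  intro n p h2 h4 X θ hXθ w hw hwQ
  obtain ⟨⟨A₀, hdim, hcm, ⟨e₀⟩⟩, hθ⟩ := hXθ
  exact h n p h2 h4 X ⟨A₀, hdim, ⟨e₀⟩⟩ θ hθ w hwQ (Ring2Transport.mem_algebraicClasses_of_cmChart hCM A₀ e₀ hdim hcm hwQ hw)

/-- **Twisted form**: `HC_CM` ∧ `∀ C n p, PinnedDesignAt (tw C AdmTw) n p` (`2 ≤ p`, `2p + 4 ≤ n`) ⟹ `CMTwistedCarriers`.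
[cite: Bloch1972Semiregularity, Remark (7.5)] [cite: Markman2025SecantWeil, §7.3] -/
theorem cmTwistedCarriers_of_HC_CM_of_forall_pinnedDesignAt (hCM : RankFourFaces.CMAbelianHodge)
    (h : ∀ (C : ChernCharacterBetti) (n p : ℕ), 2 ≤ p → 2 * p + 4 ≤ n →
      PinnedDesignAt (twistedReflexiveClass C
        (fun n X₀ I E => Summit.Ventures.HSemireg.gluableSigmaAdmissible n X₀ I E ∨
          Literature.AlgebraicGeometry.HodgeTheory.bfSingleAdmissible n X₀ I E)) n p) :
    CMTwistedCarriers :=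
  fun C ↦ cmAnchoredCarriers_of_HC_CM_of_forall_pinnedDesignAt hCM (h C)

end Summit.HodgeConjecture.HodgeConjecture.Ring2.AbelianAll

end
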